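import Mathlib
import Summits.Ventures.PercRepro2.TB14CutSplit
import Summits.Ventures.PercRepro2.PairHarris

/-!
# Typed BHK 1.4 across a cut vertex, I: the marks on opposite sides
(blind cell PercRepro2, mine-c g15, 2026-08-25; `conjectures/MINE-C.md` §24,
`proofs/MINEC-TB14BLOCK.md` §2, case 1)

Let `c` be an unmarked cut vertex separating `a₁` (side `VA`) from `a₂` (side `VB`), with `b` on the
side of `a₁` and `o` on the side of `a₂`.  Reading the separation `Q = {a₁ ↮ a₂}` through `c`
(`iQ_eq_cut`: `1_Q = 1 − 1[c ∈ C(a₁)]·1[c ∈ C(a₂)]`, both factors read on their own sides), the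
(TB14) slack `N(Q ∩ B, Q ∩ A) − N(Q ∩ A ∩ B, Q)` FACTORISES (`tb14_slack_eq_cut`):

  `D = (N_A(b ∈ C(a₁), c ∈ C'(a₁)) − N_A(b ∈ C(a₁), c ∈ C(a₁))) · (N_B(c ∈ C(a₂), o ∈ C'(a₂)) − N_B(c ∈ C(a₂), o ∈ C(a₂)))`

— the product of the `a₁`-side cross-minus-same count of the two cluster events `{b ∈ C(a₁)}`,
`{c ∈ C(a₁)}` and the `a₂`-side one of `{c ∈ C(a₂)}`, `{o ∈ C(a₂)}` (`C'` = the second copy's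
cluster), each at its side profile.  Both factors are `≤ 0` by typed Harris (`PairHarris`), so
**`tb14_of_cut_opposite`**: typed BHK 1.4 holds at every profile on every instance with such a cut
vertex — unconditionally.  Own work; standard axioms.
-/

namespace Summit.Ventures.PercRepro2

namespace TB14Cut

open CovForm A3InactiveTyped CutV

section Indicators

variable {V : Type*} {E : Type*} {R : Type*} [Field R]

omit [Field R] in
/-- `ω ∈ avoidAll ends a₂ {a₁}` iff `a₂ ↮ a₁`. -/
lemma mem_avoidAll_singleton' {ends : E → Sym2 V} {a₁ a₂ : V} {ω : Config E} :
    ω ∈ avoidAll ends a₂ {a₁} ↔ ¬ Conn ends ω a₂ a₁ := by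
  simp [avoidAll]

/-- `1_{v ∈ C(a)}` as an `if`. -/
lemma iL_eq_ite' (ends : E → Sym2 V) (a v : V) (ω : Config E) [Decidable (Conn ends ω a v)] :
    (iL ends a v ω : R) = if Conn ends ω a v then 1 else 0 := by
  by_cases h : Conn ends ω a v
  · rw [if_pos h]
    simp [iL, Set.indicator_of_mem (show ω ∈ connEvent ends a v from h)]
  · rw [if_neg h]
    simp [iL, Set.indicator_of_notMem (show ω ∉ connEvent ends a v from h)]

/-- `1_{v ∈ C₂}` as an `if`. -/
lemma iH_eq_ite' (ends : E → Sym2 V) (a v : V) (ω : Config E) [Decidable (Conn ends ω a v)] :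
    (iH ends a v ω : R) = if Conn ends ω a v then 1 else 0 := by
  by_cases h : Conn ends ω a v
  · rw [if_pos h]
    simp [iH, Set.indicator_of_mem (show ω ∈ connEvent ends a v from h)]
  · rw [if_neg h]
    simp [iH, Set.indicator_of_notMem (show ω ∉ connEvent ends a v from h)]

/-- `1_Q` as an `if`. -/
lemma iQ_eq_ite' (ends : E → Sym2 V) (a₁ a₂ : V) (ω : Config E) [Decidable (Conn ends ω a₁ a₂)] :
    (iQ ends a₁ a₂ ω : R) = if Conn ends ω a₁ a₂ then 0 else 1 := by
  by_cases h : Conn ends ω a₁ a₂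
  · have : ω ∉ avoidAll ends a₂ {a₁} := fun hω => (mem_avoidAll_singleton'.1 hω) (conn_symm h)
    rw [if_pos h]
    simp [iQ, Set.indicator_of_notMem this]
  · have : ω ∈ avoidAll ends a₂ {a₁} := mem_avoidAll_singleton'.2 (fun h' => h (conn_symm h'))
    rw [if_neg h]
    simp [iQ, Set.indicator_of_mem this]

end Indicators

section Cut

variable {V : Type*} {E : Type*} [DecidableEq E] {ends : E → Sym2 V} {c : V} {VA VB : Set V}
  {EA EB : Set E} [DecidablePred (· ∈ EA)] [DecidablePred (· ∈ EB)] {R : Type*} [Field R]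

omit [DecidableEq E] [DecidablePred (· ∈ EB)] in
/-- A cluster event of the root `a₁ ∈ VA` at a vertex `v ∈ VA ∪ {c}` is read on the side `A`. -/
lemma iL_restrict_EA (h : IsCut ends c VA VB EA EB) {a₁ v : V} (ha : a₁ ∈ VA ∪ {c})
    (hv : v ∈ VA ∪ {c}) (u : Config E) :
    (iL ends a₁ v (restrict EA u) : R) = iL ends a₁ v u := by
  classical
  rw [iL_eq_ite', iL_eq_ite', ← conn_iff_restrict h ha hv]

omit [DecidableEq E] [DecidablePred (· ∈ EA)] in
/-- A cluster event of the root `a₂ ∈ VB` at a vertex `v ∈ VB ∪ {c}` is read on the side `B`. -/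
lemma iH_restrict_EB (h : IsCut ends c VA VB EA EB) {a₂ v : V} (ha : a₂ ∈ VB ∪ {c})
    (hv : v ∈ VB ∪ {c}) (u : Config E) :
    (iH ends a₂ v (restrict EB u) : R) = iH ends a₂ v u := by
  classical
  rw [iH_eq_ite', iH_eq_ite', ← conn_iff_restrict h.symm ha hv]

omit [DecidableEq E] [DecidablePred (· ∈ EA)] [DecidablePred (· ∈ EB)] in
/-- **The separation through the cut vertex**: `1_Q = 1 − 1[c ∈ C(a₁)] · 1[c ∈ C(a₂)]`. -/
lemma iQ_eq_cut (h : IsCut ends c VA VB EA EB) {a₁ a₂ : V} (ha₁ : a₁ ∈ VA) (ha₂ : a₂ ∈ VB)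
    (u : Config E) :
    (iQ ends a₁ a₂ u : R) = 1 - iL ends a₁ c u * iH ends a₂ c u := by
  classical
  rw [iQ_eq_ite', iL_eq_ite', iH_eq_ite']
  have key : Conn ends u a₁ a₂ ↔ Conn ends u a₁ c ∧ Conn ends u a₂ c := by
    rw [conn_across_iff h ha₁ ha₂]
    constructor
    · rintro ⟨h1, h2⟩
      exact ⟨(conn_iff_restrict h (Or.inl ha₁) (Or.inr rfl)).2 h1,
        conn_symm ((conn_iff_restrict h.symm (Or.inr rfl) (Or.inl ha₂)).2 h2)⟩
    · rintro ⟨h1, h2⟩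
      exact ⟨(conn_iff_restrict h (Or.inl ha₁) (Or.inr rfl)).1 h1,
        (conn_iff_restrict h.symm (Or.inr rfl) (Or.inl ha₂)).1 (conn_symm h2)⟩
  by_cases h1 : Conn ends u a₁ c <;> by_cases h2 : Conn ends u a₂ c <;> simp [key, h1, h2]

end Cut

/-! ## The factorisation -/

section Main

variable {V : Type} {E : Type} [Fintype E] [DecidableEq E] {ends : E → Sym2 V} {c : V}
  {VA VB : Set V} {EA EB : Set E} [DecidablePred (· ∈ EA)] [DecidablePred (· ∈ EB)]
  {R : Type*} [Field R] [LinearOrder R] [IsStrictOrderedRing R]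

omit [DecidablePred (· ∈ EA)] [DecidablePred (· ∈ EB)] [LinearOrder R] [IsStrictOrderedRing R] in
/-- Linearity: the count of a negative. -/
lemma pairCount_neg' (F : Finset E) (z : Config E) (Φ : Config E → Config E → R) :
    pairCount F z (fun y w => -Φ y w) = -pairCount F z Φ := by
  have := pairCount_const_mul F z (-1 : R) Φ
  simp only [neg_one_mul] at this
  exact this

/-- **The (TB14) slack factorises across a cut vertex separating the marks**: for `a₁, b ∈ VA`
and `a₂, o ∈ VB`,
`N(Q∩B, Q∩A) − N(Q∩A∩B, Q) = (N_A(b, c') − N_A(b, c)) · (N_B(c, o') − N_B(c, o))`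
(each factor a cross-minus-same count of two cluster events of one root at its side profile). -/
theorem tb14_slack_eq_cut (h : IsCut ends c VA VB EA EB) {a₁ a₂ b o : V} (ha₁ : a₁ ∈ VA)
    (hb : b ∈ VA) (ha₂ : a₂ ∈ VB) (ho : o ∈ VB) (F : Finset E) (z : Config E) :
    pairCount F z (crossBO ends a₁ a₂ b o : Config E → Config E → R) -
        pairCount F z (sameBO ends a₁ a₂ b o) =
      (pairCount (sideFree EA F) (restrict EA z)
          (fun y w => iL ends a₁ b y * iL ends a₁ c w : Config E → Config E → R) -
        pairCount (sideFree EA F) (restrict EA z) (fun y _ => iL ends a₁ b y * iL ends a₁ c y)) *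
      (pairCount (sideFree EB F) (restrict EB z)
          (fun y w => iH ends a₂ c y * iH ends a₂ o w : Config E → Config E → R) -
        pairCount (sideFree EB F) (restrict EB z) (fun y _ => iH ends a₂ c y * iH ends a₂ o y)) := by
  -- the side invariances
  have hℓ : ∀ u : Config E, (iL ends a₁ b (restrict EA u) : R) = iL ends a₁ b u :=
    iL_restrict_EA h (Or.inl ha₁) (Or.inl hb)
  have hs : ∀ u : Config E, (iL ends a₁ c (restrict EA u) : R) = iL ends a₁ c u :=
    iL_restrict_EA h (Or.inl ha₁) (Or.inr rfl)
  have hh : ∀ u : Config E, (iH ends a₂ o (restrict EB u) : R) = iH ends a₂ o u :=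
    iH_restrict_EB h (Or.inl ha₂) (Or.inl ho)
  have ht : ∀ u : Config E, (iH ends a₂ c (restrict EB u) : R) = iH ends a₂ c u :=
    iH_restrict_EB h (Or.inl ha₂) (Or.inr rfl)
  -- the swap of the cross count
  rw [pairCount_swap F z (crossBO ends a₁ a₂ b o), ← pairCount_sub]
  -- the pointwise expansion of the difference through `iQ_eq_cut`
  have hpt : ∀ y w : Config E,
      crossBO ends a₁ a₂ b o w y - (sameBO ends a₁ a₂ b o y w : R) =
        iL ends a₁ b y * (iH ends a₂ o w - iH ends a₂ o y) -
          (iL ends a₁ b y * iL ends a₁ c y) * (iH ends a₂ c y * (iH ends a₂ o w - iH ends a₂ o y)) -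
          (iL ends a₁ b y * iL ends a₁ c w) * (iH ends a₂ c w * (iH ends a₂ o w - iH ends a₂ o y)) +
          (iL ends a₁ b y * (iL ends a₁ c y * iL ends a₁ c w)) *
            (iH ends a₂ c y * iH ends a₂ c w * (iH ends a₂ o w - iH ends a₂ o y)) := by
    intro y w
    simp only [crossBO, sameBO]
    rw [iQ_eq_cut h ha₁ ha₂ y, iQ_eq_cut h ha₁ ha₂ w]
    ring
  simp_rw [hpt]
  rw [pairCount_add, pairCount_sub, pairCount_sub]
  -- the four products factorise across the cut
  have e1 := pairCount_mul_of_cut h F z (fun y _ => (iL ends a₁ b y : R))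
    (fun y w => iH ends a₂ o w - iH ends a₂ o y)
    (by intro y w; simp only [hℓ]) (by intro y w; simp only [hh])
  have e2 := pairCount_mul_of_cut h F z (fun y _ => (iL ends a₁ b y * iL ends a₁ c y : R))
    (fun y w => iH ends a₂ c y * (iH ends a₂ o w - iH ends a₂ o y))
    (by intro y w; simp only [hℓ, hs]) (by intro y w; simp only [hh, ht])
  have e3 := pairCount_mul_of_cut h F z (fun y w => (iL ends a₁ b y * iL ends a₁ c w : R))
    (fun y w => iH ends a₂ c w * (iH ends a₂ o w - iH ends a₂ o y))
    (by intro y w; simp only [hℓ, hs]) (by intro y w; simp only [hh, ht])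
  have e4 := pairCount_mul_of_cut h F z
    (fun y w => (iL ends a₁ b y * (iL ends a₁ c y * iL ends a₁ c w) : R))
    (fun y w => iH ends a₂ c y * iH ends a₂ c w * (iH ends a₂ o w - iH ends a₂ o y))
    (by intro y w; simp only [hℓ, hs]) (by intro y w; simp only [hh, ht])
  rw [e1, e2, e3, e4]
  -- the `B`-side swap symmetries
  have hB1 : pairCount (sideFree EB F) (restrict EB z)
      (fun y w => iH ends a₂ o w - iH ends a₂ o y : Config E → Config E → R) = 0 := by
    rw [pairCount_sub, pairCount_swap (sideFree EB F) (restrict EB z) (fun y _ => iH ends a₂ o y),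
      sub_self]
  have hB2 : pairCount (sideFree EB F) (restrict EB z)
      (fun y w => iH ends a₂ c y * (iH ends a₂ o w - iH ends a₂ o y) : Config E → Config E → R) =
      pairCount (sideFree EB F) (restrict EB z)
          (fun y w => iH ends a₂ c y * iH ends a₂ o w : Config E → Config E → R) -
        pairCount (sideFree EB F) (restrict EB z) (fun y _ => iH ends a₂ c y * iH ends a₂ o y) := by
    rw [← pairCount_sub]
    congr 1
    funext y w
    ring
  have hB3 : pairCount (sideFree EB F) (restrict EB z)
      (fun y w => iH ends a₂ c w * (iH ends a₂ o w - iH ends a₂ o y) : Config E → Config E → R) =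
      - pairCount (sideFree EB F) (restrict EB z)
        (fun y w => iH ends a₂ c y * (iH ends a₂ o w - iH ends a₂ o y)) := by
    rw [pairCount_swap (sideFree EB F) (restrict EB z)
      (fun y w => iH ends a₂ c w * (iH ends a₂ o w - iH ends a₂ o y)), ← pairCount_neg']
    congr 1
    funext y w
    ring
  have hB4 : pairCount (sideFree EB F) (restrict EB z)
      (fun y w => iH ends a₂ c y * iH ends a₂ c w * (iH ends a₂ o w - iH ends a₂ o y) :
        Config E → Config E → R) = 0 := by
    have hsw := pairCount_swap (sideFree EB F) (restrict EB z)
      (fun y w => iH ends a₂ c y * iH ends a₂ c w * (iH ends a₂ o w - iH ends a₂ o y) :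
        Config E → Config E → R)
    have hneg : pairCount (sideFree EB F) (restrict EB z)
        (fun y w => iH ends a₂ c w * iH ends a₂ c y * (iH ends a₂ o y - iH ends a₂ o w) :
          Config E → Config E → R) =
        - pairCount (sideFree EB F) (restrict EB z)
          (fun y w => iH ends a₂ c y * iH ends a₂ c w * (iH ends a₂ o w - iH ends a₂ o y)) := by
      rw [← pairCount_neg']
      congr 1
      funext y w
      ring
    rw [hneg] at hsw
    linarith
  rw [hB1, hB3, hB4, hB2]
  ring

/-- **Typed BHK 1.4 across a cut vertex separating the marks** (THEOREM, unconditional): if an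
unmarked cut vertex `c` separates `a₁, b` from `a₂, o`, then at every profile
`N(Q ∩ A ∩ B, Q) ≤ N(Q ∩ B, Q ∩ A)` — both factors of `tb14_slack_eq_cut` are `≤ 0` by typed
Harris on one root. -/
theorem tb14_of_cut_opposite (h : IsCut ends c VA VB EA EB) {a₁ a₂ b o : V} (ha₁ : a₁ ∈ VA)
    (hb : b ∈ VA) (ha₂ : a₂ ∈ VB) (ho : o ∈ VB) (F : Finset E) (z : Config E) :
    pairCount F z (sameBO ends a₁ a₂ b o : Config E → Config E → R) ≤
      pairCount F z (crossBO ends a₁ a₂ b o) := by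
  rw [← sub_nonneg, tb14_slack_eq_cut h ha₁ hb ha₂ ho F z]
  have hA := PairHarris.pairCount_harris_iL (R := R) ends a₁ b c (sideFree EA F) (restrict EA z)
  have hB := PairHarris.pairCount_harris_iH (R := R) ends a₂ c o (sideFree EB F) (restrict EB z)
  rw [← neg_mul_neg]
  exact mul_nonneg (neg_nonneg.2 (sub_nonpos.2 hA)) (neg_nonneg.2 (sub_nonpos.2 hB))

end Main

end TB14Cut

end Summit.Ventures.PercRepro2
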